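import Literature.MathematicalPhysics.QuantumLattice.KomaPiFluxSuperconductingOrder
import HarnessLib

/-!
# Koma 2022, Theorem 2.1 as printed: `m_LRO ≥ 1/50` for the `π`-flux BCS Hamiltonian (2.4)–(2.9) with
# the staggered order parameter (2.5), `|κ| ≤ g/1000`, low temperature, every dimension `D ≥ 3`

T. Koma, *Nambu–Goldstone modes for superconducting lattice fermions*, arXiv:2201.13135 (2022)
[Koma2022]: (2.5) `O = Σ_x (-1)^{x(1)+⋯+x(d)} i(a†_{x↑}a†_{x↓} - a_{x↓}a_{x↑})`, (2.11)
`m^{(Λ)}_LRO = |Λ|⁻¹ √⟨[O^{(Λ)}]²⟩_{β,0}`, and Theorem 2.1 (`d ≥ 3`, `B = 0`: `m_LRO > 0` for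
`|κ|/g ≤ κ̂`, `β ≥ β_c`; here `g' = 0`).

`KomaPiFluxSuperconductingOrder.superconductingOrder` proves the theorem in Lieb's reflection frame
(`lroSq β H₀ ≥ 1/2000`, `H₀ = KomaPiFlux.hamiltonian κ U g 0 0`, `0 ≤ κ ≤ g/1000`, `U ≤ -2Dg`). This file
transports it to the printed objects:

* `gibbsState_gammaOne_mul_neg_kappa`, `lroSq_neg_kappa` — the sign of `κ` is a `ℤ₂` gauge for the Gibbs
  state as well:
  `lroSq β H₀(-κ) = lroSq β H₀(κ)` (the gauge `(-1)^x` flips `T_π(κ)` and fixes every `Γ¹_x`), hence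
  `superconductingOrder_abs` (`|κ| ≤ g/1000`);
* `mLRO` — Koma's `m^{(Λ)}_LRO` of (2.11) for the printed Hamiltonian `H = H_hop + H_int` ((2.4) at
  `B = 0`, `h = 0`) and the printed `O` of (2.5), on the even torus of side `L`;
* `re_gibbsState_printedOrder_sq` — `⟨O²⟩_{β,H} = Σ_{x,y} Re⟨Γ¹_xΓ¹_y⟩_{β,H₀(U=-2Dg)}` (unitary
  equivalence `KomaPiFluxPrintedModel.orbitalPhaseAut_hamiltonian_eq_printed` up to a constant, which the
  Gibbs state does not see, and the `η`-rotation symmetry `⟨Γ²Γ²⟩ = ⟨Γ¹Γ¹⟩`,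
  `KomaPiFluxEtaRotationSymmetry`), i.e. `mLRO = √(lroSq β H₀)` ((6.18)–(6.19));
* **`printed_superconductingOrder`** — THEOREM 2.1: in `D = d + 1 ≥ 3` directions, for `g > 0` and
  `|κ| ≤ g/1000` there are `β₀ > 0`, `k₀` with **`m^{(Λ)}_LRO ≥ 1/50`** for all `β ≥ β₀` and all tori of
  side `2k`, `k ≥ k₀`; in particular `m_LRO = lim_Λ m^{(Λ)}_LRO ≥ 1/50 > 0` whenever the limit (2.12)
  exists.

No named fact; one definition (`mLRO`, with body, as printed).

## References

* [Koma2022] T. Koma, arXiv:2201.13135, (2.4)–(2.12), Theorem 2.1, (6.18)–(6.19).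
* [BratteliRobinson1997] O. Bratteli, D. W. Robinson, *Operator Algebras and Quantum Statistical
  Mechanics 2*, §5.3.1 (unitary covariance of Gibbs states).
-/

noncomputable section

/-! ### Gibbs states under unitary conjugation and constant shifts (plumbing) -/

namespace Matrix

open NormedSpace
open scoped Matrix.Norms.L2Operator

variable {n : Type*} [Fintype n] [DecidableEq n]

/-- `e^{-β UHU*} = U e^{-βH} U*` for unitary `U`. [folklore] -/
private theorem gibbsWeight_unitary_conj {U : Matrix n n ℂ} (hU : U ∈ unitary (Matrix n n ℂ)) (β : ℝ)
    (H : Matrix n n ℂ) : gibbsWeight β (U * H * star U) = U * gibbsWeight β H * star U := by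
  have hunit : IsUnit U := ⟨Unitary.toUnits ⟨U, hU⟩, rfl⟩
  have hinv : U⁻¹ = star U := by
    rw [Matrix.inv_eq_right_inv (Unitary.mul_star_self_of_mem hU)]
  rw [gibbsWeight, gibbsWeight, ← hinv, show -(β : ℂ) • (U * H * U⁻¹) = U * (-(β : ℂ) • H) * U⁻¹ by
    rw [Matrix.mul_smul, Matrix.smul_mul], Matrix.exp_conj _ _ hunit]

/-- **Unitary covariance of Gibbs states**: `⟨UAU*⟩_{β,UHU*} = ⟨A⟩_{β,H}`.
[cite: BratteliRobinson1997, §5.3.1] -/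
theorem gibbsState_unitary_conj' {U : Matrix n n ℂ} (hU : U ∈ unitary (Matrix n n ℂ)) (β : ℝ)
    (H A : Matrix n n ℂ) : gibbsState β (U * H * star U) (U * A * star U) = gibbsState β H A := by
  have hUU : star U * U = 1 := Unitary.star_mul_self_of_mem hU
  rw [gibbsState_apply, gibbsState_apply, partitionFn_unitary_conj hU, gibbsWeight_unitary_conj hU]
  congr 1
  have e : U * gibbsWeight β H * star U * (U * A * star U) = U * (gibbsWeight β H * A) * star U := by
    calc U * gibbsWeight β H * star U * (U * A * star U)
        = U * gibbsWeight β H * (star U * U) * A * star U := by simp only [Matrix.mul_assoc]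
      _ = U * (gibbsWeight β H * A) * star U := by rw [hUU, Matrix.mul_one, Matrix.mul_assoc U]
  rw [e, trace_mul_cycle, hUU, Matrix.one_mul]

/-- **A constant shift of the Hamiltonian does not change the Gibbs state**:
`⟨A⟩_{β,H + r·1} = ⟨A⟩_{β,H}`. [cite: BratteliRobinson1997, §5.3.1] -/
theorem gibbsState_add_real_smul_one (β : ℝ) (H A : Matrix n n ℂ) (r : ℝ) :
    gibbsState β (H + (r : ℂ) • 1) A = gibbsState β H A := by
  have hsplit : -(β : ℂ) • (H + (r : ℂ) • 1) = -(β : ℂ) • H + ((-(β * r) : ℝ) : ℂ) • (1 : Matrix n n ℂ) := by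
    push_cast
    module
  have hc : Commute (-(β : ℂ) • H) (((-(β * r) : ℝ) : ℂ) • (1 : Matrix n n ℂ)) :=
    (Commute.one_right _).smul_right _
  have hW : gibbsWeight β (H + (r : ℂ) • 1) = (Real.exp (-(β * r)) : ℂ) • gibbsWeight β H := by
    rw [gibbsWeight, gibbsWeight, hsplit, Matrix.exp_add_of_commute _ _ hc,
      ← Algebra.algebraMap_eq_smul_one, ← algebraMap_exp_comm, ← Complex.exp_eq_exp_ℂ,
      ← Complex.ofReal_exp, Algebra.algebraMap_eq_smul_one, Matrix.mul_smul, Matrix.mul_one]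
  have hne : (Real.exp (-(β * r)) : ℂ) ≠ 0 := Complex.ofReal_ne_zero.2 (Real.exp_pos _).ne'
  rw [gibbsState_apply, gibbsState_apply, partitionFn, partitionFn, hW, Matrix.smul_mul, trace_smul,
    trace_smul, smul_eq_mul, smul_eq_mul, mul_inv, mul_mul_mul_comm, inv_mul_cancel₀ hne, one_mul]

end Matrix

namespace Literature.MathematicalPhysics.QuantumLattice

open Matrix Finset Filter HubbardWave0 PairHopRP FermionTorus LiebCutRP NormedSpace
open Literature.Probability.LatticeModels

namespace KomaPiFlux

attribute [local instance] LiebCutRP.decEqTorus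

variable {d L : ℕ} [NeZero L]

/-! ### The sign of `κ` is a gauge, for the Gibbs state -/

/-- `(-1)^x (-1)^y T_π(κ)(x,y) = T_π(-κ)(x,y)` (adjacent sites have opposite parity on the even torus;
`T_π` vanishes off the bonds). [cite: Koma2022, §4.1] [cite: Lieb1994, p. 3] -/
theorem stagSign_mul_piFluxAmpl (hL : Even L) (h2 : 2 ≤ L) (κ : ℝ) (σ : Fin 2) (x y : FermionTorus (d + 1) L) :
    ((stagSign x : ℂ) * star (stagSign y : ℂ)) * piFluxAmpl κ σ x y = piFluxAmpl (-κ) σ x y := by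
  rw [Complex.star_def, Complex.conj_ofReal]
  by_cases hxy : (G d L).Adj x y
  · have hy : stagSign y = -stagSign x := by
      rcases (adj_iff_shift_or_unshift h2 x y).1 hxy with ⟨μ, rfl⟩ | ⟨μ, rfl⟩
      · exact stagSign_shift hL x μ
      · have h := stagSign_shift hL (unshift x μ) μ
        rw [shift_unshift] at h
        linarith
    rw [hy, Complex.ofReal_neg, mul_neg, ← Complex.ofReal_mul, stagSign_sq, piFluxAmpl_neg]
    push_cast
    ring
  · rw [piFluxAmpl_of_not_adj h2 κ σ hxy, piFluxAmpl_of_not_adj h2 (-κ) σ hxy, mul_zero]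

/-- **The `ℤ₂` gauge `(-1)^x` on the Gibbs state**: `⟨Γ¹_xΓ¹_y⟩_{β,H₀(-κ)} = ⟨Γ¹_xΓ¹_y⟩_{β,H₀(κ)}` (the gauge
conjugates `H₀(κ)` to `H₀(-κ)` and fixes every `Γ¹_x`). [cite: Koma2022, §4.1] [cite: Lieb1994, p. 3] -/
theorem gibbsState_gammaOne_mul_neg_kappa (hL : Even L) (h2 : 2 ≤ L) (β κ U g : ℝ) (x y : FermionTorus (d + 1) L) :
    gibbsState β (hamiltonian (-κ) U g (fun (_ _ : FermionTorus (d + 1) L) => (0 : ℝ)) 0) (gammaOne x * gammaOne y) =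
      gibbsState β (hamiltonian κ U g (fun (_ _ : FermionTorus (d + 1) L) => (0 : ℝ)) 0) (gammaOne x * gammaOne y) := by
  obtain ⟨ph, hph_def⟩ : ∃ ph : Fin 2 → FermionTorus (d + 1) L → ℂ, ph = fun _ x => (stagSign x : ℂ) :=
    ⟨_, rfl⟩
  have hph : ∀ (σ : Fin 2) (x : FermionTorus (d + 1) L), ‖ph σ x‖ = 1 := fun σ x => by
    rcases stagSign_eq_or x with h1 | h1 <;> simp [hph_def, h1]
  have hprod : ∀ x : FermionTorus (d + 1) L, ph 0 x * ph 1 x = 1 := fun x => by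
    simp only [hph_def, ← Complex.ofReal_mul, stagSign_sq, Complex.ofReal_one]
  have hH : orbitalPhaseAut (g := spinSitePhase ph) (fun _ => hph _ _)
      (hamiltonian κ U g (fun (_ _ : FermionTorus (d + 1) L) => (0 : ℝ)) 0) =
      hamiltonian (-κ) U g (fun (_ _ : FermionTorus (d + 1) L) => (0 : ℝ)) 0 := by
    rw [hamiltonian, PairHopRP.orbitalPhaseAut_hamiltonian (G d L) hph hprod, hamiltonian]
    congr 1
    funext σ x y
    simp only [hph_def]
    exact stagSign_mul_piFluxAmpl hL h2 κ σ x y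
  have hA : orbitalPhaseAut (g := spinSitePhase ph) (fun _ => hph _ _) (gammaOne x * gammaOne y) =
      gammaOne x * gammaOne y := by
    rw [map_mul, PairHopRP.orbitalPhaseAut_gammaOne hph hprod, PairHopRP.orbitalPhaseAut_gammaOne hph hprod]
  have key := Matrix.gibbsState_unitary_conj' (orbitalPhase_mem_unitary (g := spinSitePhase ph) fun _ => hph _ _) β
    (hamiltonian κ U g (fun (_ _ : FermionTorus (d + 1) L) => (0 : ℝ)) 0) (gammaOne x * gammaOne y)
  rw [star_eq_conjTranspose, ← orbitalPhaseAut_apply (fun _ => hph _ _), ← orbitalPhaseAut_apply (fun _ => hph _ _),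
    hH, hA] at key
  exact key

/-- **`lroSq` is even in `κ`.** [cite: Koma2022, §4.1] [cite: Lieb1994, p. 3] -/
theorem lroSq_neg_kappa (hL : Even L) (h2 : 2 ≤ L) (β κ U g : ℝ) :
    lroSq β (hamiltonian (-κ) U g (fun (_ _ : FermionTorus (d + 1) L) => (0 : ℝ)) 0) =
      lroSq β (hamiltonian κ U g (fun (_ _ : FermionTorus (d + 1) L) => (0 : ℝ)) 0) := by
  simp only [lroSq, pairCorr, gibbsState_gammaOne_mul_neg_kappa hL h2]

/-- **Theorem 2.1 in Lieb's frame for both signs of `κ`**: `|κ| ≤ g/1000`, `U + 2g(d+1) ≤ 0`, `D = d+1 ≥ 3`.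
[cite: Koma2022, Theorem 2.1] -/
theorem superconductingOrder_abs (hd : 2 ≤ d) {κ U g : ℝ} (hg : 0 < g) (hκg : |κ| ≤ g / 1000)
    (hU : U + 2 * g * (d + 1) ≤ 0) :
    ∃ β₀ : ℝ, ∃ k₀ : ℕ, 0 < β₀ ∧ ∀ β : ℝ, β₀ ≤ β → ∀ k : ℕ, k₀ ≤ k → ∀ [NeZero (2 * k)],
      (1 / 2000 : ℝ) ≤ lroSq β (hamiltonian κ U g (fun (_ _ : FermionTorus (d + 1) (2 * k)) => (0 : ℝ)) 0) := by
  rcases le_or_gt 0 κ with hκ | hκ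
  · rw [abs_of_nonneg hκ] at hκg
    exact superconductingOrder hd hg hκ hκg hU
  · rw [abs_of_neg hκ] at hκg
    obtain ⟨β₀, k₀, hβ₀, h⟩ := superconductingOrder hd hg (by linarith : 0 ≤ -κ) hκg hU
    refine ⟨β₀, max k₀ 1, hβ₀, fun β hβ k hk _ => ?_⟩
    have h' := h β hβ k (le_trans (le_max_left _ _) hk)
    rwa [lroSq_neg_kappa (even_two_mul k) (by omega)] at h'

/-! ### Koma's order parameter as printed -/

/-- **Koma's long-range order parameter (2.11)** for the printed Hamiltonian (2.4) at `B = 0` (and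
`h = 0`, `g' = 0`): `m^{(Λ)}_LRO = |Λ|⁻¹ √⟨[O^{(Λ)}]²⟩_β`, with the staggered `O` of (2.5).
[cite: Koma2022, (2.5), (2.11)] -/
def mLRO (β κ g : ℝ) : ℝ :=
  Real.sqrt ((gibbsState β (printedHamiltonian κ g (fun (_ : Fin (d + 1)) (_ : FermionTorus (d + 1) L) => (0 : ℝ)) 0)
      (printedOrder * printedOrder)).re) /
    (Fintype.card (FermionTorus (d + 1) L) : ℝ)

/-- **`⟨O²⟩_{β,H} = Σ_{x,y}Re⟨Γ¹_xΓ¹_y⟩_{β,H₀}`** with `H₀ = H_Lieb(κ, U = -2Dg, g)`: the printed Hamiltonian is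
`𝒰H₀𝒰† - (Dg|Λ|/2)·1` and `O = 𝒰(Σ_xΓ²_x)𝒰†` (`KomaPiFluxPrintedModel`), the Gibbs state is covariant and
blind to constants, and `⟨Γ²_xΓ²_y⟩ = ⟨Γ¹_xΓ¹_y⟩` by the `η`-rotation symmetry. [cite: Koma2022, (2.11), (6.5), (6.18)–(6.19)] -/
theorem re_gibbsState_printedOrder_sq (hL : Even L) (h4 : 4 ≤ L) (β κ g : ℝ) :
    (gibbsState β (printedHamiltonian κ g (fun (_ : Fin (d + 1)) (_ : FermionTorus (d + 1) L) => (0 : ℝ)) 0)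
        (printedOrder * printedOrder)).re =
      ∑ x : FermionTorus (d + 1) L, ∑ y : FermionTorus (d + 1) L,
        pairCorr β (hamiltonian κ (-2 * (d + 1 : ℕ) * g) g (fun (_ _ : FermionTorus (d + 1) L) => (0 : ℝ)) 0) x y := by
  set H₀ := hamiltonian κ (-2 * (d + 1 : ℕ) * g) g (fun (_ _ : FermionTorus (d + 1) L) => (0 : ℝ)) 0 with hH₀
  have key := orbitalPhaseAut_hamiltonian_eq_printed hL h4 κ g
    (fun (_ : Fin (d + 1)) (_ : FermionTorus (d + 1) L) => (0 : ℝ)) 0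
  rw [bondField_zero, ← hH₀] at key
  set c : ℝ := (d + 1 : ℕ) * g * Fintype.card (FermionTorus (d + 1) L) / 2 with hc
  have hprinted : printedHamiltonian κ g (fun (_ : Fin (d + 1)) (_ : FermionTorus (d + 1) L) => (0 : ℝ)) 0 =
      orbitalPhaseAut (g := spinSitePhase komaPhase) (fun _ => norm_komaPhase _ _) H₀ + ((-c : ℝ) : ℂ) • 1 := by
    rw [key, Complex.ofReal_neg, neg_smul, add_neg_cancel_right]
  have hO : (printedOrder : Matrix (Finset (Orb (FermionTorus (d + 1) L))) _ ℂ) * printedOrder =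
      orbitalPhaseAut (g := spinSitePhase komaPhase) (fun _ => norm_komaPhase _ _)
        (orderParameter * orderParameter) := by
    rw [map_mul, orbitalPhaseAut_orderParameter_eq_printed]
  have key := Matrix.gibbsState_unitary_conj'
    (orbitalPhase_mem_unitary (g := spinSitePhase (komaPhase (d := d) (L := L))) fun _ => norm_komaPhase _ _) β H₀
    (orderParameter * orderParameter)
  rw [star_eq_conjTranspose, ← orbitalPhaseAut_apply (fun _ => norm_komaPhase _ _),
    ← orbitalPhaseAut_apply (fun _ => norm_komaPhase _ _)] at key
  rw [hprinted, hO, Matrix.gibbsState_add_real_smul_one, key, orderParameter, Finset.sum_mul_sum, map_sum,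
    Complex.re_sum]
  refine Finset.sum_congr rfl fun x _ => ?_
  rw [map_sum, Complex.re_sum]
  refine Finset.sum_congr rfl fun y _ => ?_
  rw [pairCorr, hH₀, hamiltonian, PairHopRP.gibbsState_gammaOne_mul_eq]

/-- **`m^{(Λ)}_LRO = √(lroSq β H₀)`**, `H₀ = H_Lieb(κ, -2Dg, g)` ((2.11) versus (6.18)–(6.19)).
[cite: Koma2022, (2.11), (6.18)–(6.19)] -/
theorem mLRO_eq_sqrt_lroSq (hL : Even L) (h4 : 4 ≤ L) (β κ g : ℝ) :
    mLRO (d := d) (L := L) β κ g =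
      Real.sqrt (lroSq β (hamiltonian κ (-2 * (d + 1 : ℕ) * g) g (fun (_ _ : FermionTorus (d + 1) L) => (0 : ℝ)) 0)) := by
  have hN : (0 : ℝ) < (Fintype.card (FermionTorus (d + 1) L) : ℝ) := by
    exact_mod_cast Fintype.card_pos
  rw [mLRO, re_gibbsState_printedOrder_sq hL h4, lroSq, Real.sqrt_div' _ (sq_nonneg _), Real.sqrt_sq hN.le]

/-- **Koma's Theorem 2.1, as printed (`g' = 0`), every dimension `D = d + 1 ≥ 3`.** For `g > 0` and
`|κ| ≤ g/1000` there are `β₀ > 0` (depending on `g`, `D`) and `k₀` such that for every `β ≥ β₀` and every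
`k ≥ k₀`, on the torus of side `2k` with the antiperiodic `π`-flux hopping (2.7)–(2.9) and the BCS pair
interaction (2.6): **`m^{(Λ)}_LRO ≥ 1/50`**. Hence `m_LRO = lim_Λ m^{(Λ)}_LRO > 0` ((2.12)) whenever the limit
exists: superconducting long-range order. [cite: Koma2022, Theorem 2.1] -/
theorem printed_superconductingOrder (hd : 2 ≤ d) {κ g : ℝ} (hg : 0 < g) (hκg : |κ| ≤ g / 1000) :
    ∃ β₀ : ℝ, ∃ k₀ : ℕ, 0 < β₀ ∧ ∀ β : ℝ, β₀ ≤ β → ∀ k : ℕ, k₀ ≤ k → ∀ [NeZero (2 * k)],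
      (1 / 50 : ℝ) ≤ mLRO (d := d) (L := 2 * k) β κ g := by
  have hU : (-2 * (d + 1 : ℕ) * g : ℝ) + 2 * g * (d + 1) ≤ 0 := by push_cast; linarith
  obtain ⟨β₀, k₀, hβ₀, h⟩ := superconductingOrder_abs hd hg hκg hU
  refine ⟨β₀, max k₀ 2, hβ₀, fun β hβ k hk _ => ?_⟩
  have hk2 : 2 ≤ k := le_trans (le_max_right _ _) hk
  have h' := h β hβ k (le_trans (le_max_left _ _) hk)
  rw [mLRO_eq_sqrt_lroSq (even_two_mul k) (by omega)]
  calc (1 / 50 : ℝ) = Real.sqrt ((1 / 50) ^ 2) := (Real.sqrt_sq (by norm_num)).symm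
    _ ≤ Real.sqrt (1 / 2000) := Real.sqrt_le_sqrt (by norm_num)
    _ ≤ _ := Real.sqrt_le_sqrt h'

end KomaPiFlux

end Literature.MathematicalPhysics.QuantumLattice

end
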